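import Summits.QuantumFields.QCD.Theses.MultibosonBridge

/-!
# Birth skeleton for the piece `GapTransferR3` (stmt-QuantumFields-11439) of the split of `FullLatticeGapC` (stmt-QuantumFields-17619)

Extracted verbatim from the registered line `Cruxes/FullLatticeGapC/Lines/multiboson_split.lean` (strategist seat
`planner-cstrat-stmt-QuantumFields-17619-r1-0`, 2026-08-17) so that the piece carries ITS OWN two stubs and composition:
T1 `stub_seaTransfer` (R-reweighting only: signed gap for quark-free observables, Δ' ≤ Δ) and
T2 `stub_valenceLines` (quark-free signed gap + dilute tail ⇒ all observables, Δ'' ≤ Δ') ⟹ `gapTransferR3_of_stubs`.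
`lean check` rc 0 with `sorry` only inside the two `stub_*`; the composition concludes
`Summit.QuantumFields.QCD.Theses.MultibosonBridge.GapTransferR3` BY NAME. Card: `Lines/multiboson_split.md`.
-/

namespace Summit.QuantumFields.QCD.Cruxes.FullLatticeGapC.MultibosonSplit.BirthR3

open Literature.MathematicalPhysics.QuantumFieldTheory
open Summit.QuantumFields.QCD.Theses.MultibosonBridge (MultibosonLatticeGapR4 GapTransferR3
  FullLatticeGapC)
open Filter

/-- **T1 — sea transfer (piece `GapTransferR3`, stub 1 of 2).** Along `reg.scheme m 0 0`
(`N_f ∈ {2,3}`, mass scaling, asymptotic scaling, `m > 0`, physical branch), tied admissible data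
with a dilute tail and a bosonised gap `Δ > 0` give, for some `Δ' ∈ (0, Δ]`, volume-uniform
exponential decay at rate `Δ'` of the SIGNED lattice-QCD connected correlations of every pair of
QUARK-FREE gauge-invariant local observables (`A.F U = g(U)·1`: Wilson loops, plaquette
polynomials). Mechanism: for gluonic `a, b` one has `⟨a b⟩_QCD = E^bos[a b R] / E^bos[R]` exactly
(`ReweightingIdentity`, no Wick contraction), with `R = ∏_f ∏_i λ_{f,i} q_f(λ_{f,i})` = a
`δ_k`-small strictly local bulk factor (IR-irrelevant by the rate tie) × a dilute repulsive defect
gas (the tail); transfer the gap through this reweighting. Why it might fail: `log R` is extensive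
with physical range growing like `log(1/a_k)·Z_m(k)/m`, so a single-scale cluster expansion gives
`Δ'_k → 0`; covariance decay of `μ^bos` is weak mixing only (`d > 2`); sign of `E^bos[R]` at
`N_f = 3`. Size: XL. -/
theorem stub_seaTransfer :
    ∀ (Nf : ℕ) (reg : QCDRegularisation Nf) (m : Fin Nf → ℝ) (ε δ p : ℕ → ℝ) (ℓ : ℕ → ℕ)
      (κ : ℕ → Fin Nf → ℝ) (ν : ℕ → Fin Nf → List ℂ) (Δ : ℝ),
      Nf = 2 ∨ Nf = 3 → reg.HasMassScaling → (reg.scheme 0 0 0).HasAsymptoticScaling →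
      (∀ f, 0 < m f) → (∀ f, ∀ᶠ k in atTop, -1 < (reg.scheme m 0 0).mq f k) →
      IsAdmissibleMultibosonDataR (reg.scheme m 0 0) ε δ ℓ κ ν →
      Tendsto (fun k => δ k / reg.a k ^ 2) atTop (nhds 0) →
      HasSpectralTailDomination (reg.scheme m 0 0) ε p ℓ ν → 0 < Δ →
      (reg.scheme m 0 0).HasMultibosonLatticeGap ν Δ →
      ∃ Δ' : ℝ, 0 < Δ' ∧ Δ' ≤ Δ ∧
        ∀ (R R' : ℕ) (A : QCDLatticeObservable Nf R) (B : QCDLatticeObservable Nf R'),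
          (∃ g : Literature.MathematicalPhysics.QuantumLattice.LGConfig 4
              (Matrix.specialUnitaryGroup (Fin 3) ℂ) → ℂ, ∀ U, A.F U = algebraMap ℂ _ (g U)) →
          (∃ g : Literature.MathematicalPhysics.QuantumLattice.LGConfig 4
              (Matrix.specialUnitaryGroup (Fin 3) ℂ) → ℂ, ∀ U, B.F U = algebraMap ℂ _ (g U)) →
          ∃ C : ℝ, ∀ᶠ k in atTop, ∀ S : ℕ, (reg.scheme m 0 0).L k ≤ S → ∀ n : ℕ, n ≤ S →
            ‖qcdLatticeConnectedCorr ((reg.scheme m 0 0).β k) (2 * S + 1)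
                (fun fl => (reg.scheme m 0 0).mq fl k) A B n‖ ≤
              C * Real.exp (-(Δ' * ((reg.scheme m 0 0).a k * n))) := by
  sorry

/-- **T2 — massive valence lines (piece `GapTransferR3`, stub 2 of 2).** Along the same schemes,
tied admissible data with a dilute tail and a gap `Δ' > 0` of SIGNED lattice QCD on quark-free
observables upgrade to QCD's full `HasLatticeMassGap Δ''` for some `Δ'' ∈ (0, Δ']` — all
gauge-invariant local observables with quark content (mesons, baryons, their products with loops).
Mechanism: Wick-contract the boxed quark polynomials; under the signed measure `det D · D⁻¹ = adj D`
is polynomial, and with the admissible filter the propagators are the bounded, strictly finite-range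
polynomials `q_f(H_f)² H_f γ₅` up to tail defects, so hadron correlators become gluonic correlators
of quasi-local functionals plus dilute-defect corrections. Why it might fail: at supercritical
hopping (`m_f(k) < 0` on the honest line) `D_W` is not configuration-wise coercive — exceptional
configurations carry long-range quark propagation, and tail-rarity is known under `μ^bos` only, so
moment bounds for `adj D` under the signed measure are needed (Banks–Casher-type obstruction at
`m → 0`). Size: L–XL. -/
theorem stub_valenceLines :
    ∀ (Nf : ℕ) (reg : QCDRegularisation Nf) (m : Fin Nf → ℝ) (ε δ p : ℕ → ℝ) (ℓ : ℕ → ℕ)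
      (κ : ℕ → Fin Nf → ℝ) (ν : ℕ → Fin Nf → List ℂ) (Δ' : ℝ),
      Nf = 2 ∨ Nf = 3 → reg.HasMassScaling → (reg.scheme 0 0 0).HasAsymptoticScaling →
      (∀ f, 0 < m f) → (∀ f, ∀ᶠ k in atTop, -1 < (reg.scheme m 0 0).mq f k) →
      IsAdmissibleMultibosonDataR (reg.scheme m 0 0) ε δ ℓ κ ν →
      Tendsto (fun k => δ k / reg.a k ^ 2) atTop (nhds 0) →
      HasSpectralTailDomination (reg.scheme m 0 0) ε p ℓ ν → 0 < Δ' →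
      (∀ (R R' : ℕ) (A : QCDLatticeObservable Nf R) (B : QCDLatticeObservable Nf R'),
          (∃ g : Literature.MathematicalPhysics.QuantumLattice.LGConfig 4
              (Matrix.specialUnitaryGroup (Fin 3) ℂ) → ℂ, ∀ U, A.F U = algebraMap ℂ _ (g U)) →
          (∃ g : Literature.MathematicalPhysics.QuantumLattice.LGConfig 4
              (Matrix.specialUnitaryGroup (Fin 3) ℂ) → ℂ, ∀ U, B.F U = algebraMap ℂ _ (g U)) →
          ∃ C : ℝ, ∀ᶠ k in atTop, ∀ S : ℕ, (reg.scheme m 0 0).L k ≤ S → ∀ n : ℕ, n ≤ S →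
            ‖qcdLatticeConnectedCorr ((reg.scheme m 0 0).β k) (2 * S + 1)
                (fun fl => (reg.scheme m 0 0).mq fl k) A B n‖ ≤
              C * Real.exp (-(Δ' * ((reg.scheme m 0 0).a k * n)))) →
      ∃ Δ'' : ℝ, 0 < Δ'' ∧ Δ'' ≤ Δ' ∧ (reg.scheme m 0 0).HasLatticeMassGap Δ'' := by
  sorry

/-- Piece 2 (`GapTransferR3`, stmt-QuantumFields-11439) from T1 and T2: sea transfer to the gluonic signed
gap `Δ' ≤ Δ`, then valence upgrade to the full gap `Δ'' ≤ Δ'`. [folklore] -/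
theorem gapTransferR3_of_stubs : GapTransferR3 := by
  intro Nf reg m ε δ p ℓ κ ν Δ hNf hms has hm hbr hAdm hRate hTail hΔ hGap
  obtain ⟨Δ', hΔ', hle', hGlue⟩ :=
    stub_seaTransfer Nf reg m ε δ p ℓ κ ν Δ hNf hms has hm hbr hAdm hRate hTail hΔ hGap
  obtain ⟨Δ'', hΔ'', hle'', hFull⟩ :=
    stub_valenceLines Nf reg m ε δ p ℓ κ ν Δ' hNf hms has hm hbr hAdm hRate hTail hΔ' hGlue
  exact ⟨Δ'', hΔ'', hle''.trans hle', hFull⟩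

end Summit.QuantumFields.QCD.Cruxes.FullLatticeGapC.MultibosonSplit.BirthR3
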